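import Mathlib.Analysis.Calculus.ContDiff.Bounds
import Mathlib.Analysis.InnerProductSpace.EuclideanDist
import Literature.Analysis.FluidPDE.CompressibleEulerImplosionFarField
import Mathlib.Analysis.SpecialFunctions.SmoothTransition
import Mathlib.Analysis.InnerProductSpace.Calculus
import HarnessLib

/-!
# The far field of the implosion profile: bounded derivatives of all orders, cut-offs, and the
# exact solution in far-field form (theorems only)

Topic `Literature/Analysis/FluidPDE`; namespace `Literature.Analysis.FluidPDE.CaolaboraEtAl2025`.
Companion of `CompressibleEulerImplosionFarField.lean` (`farField_of_profile`: the `γ = 5/3`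
profile `(U, S)` of Buckmaster–Cao-Labora–Gómez-Serrano, Thm 1.1, is `U = ζ^{1−r}A(ζ^{−r})`,
`S = ζ^{1−r}B(ζ^{−r})` with `A, B` smooth on `ℝ`, `B(0) > 0`) and of
`CompressibleEulerExactSelfSimilarImplosion.lean` (the exact self-similar solution). THEOREMS
ONLY, no definitions, no new facts. Consequences of the far-field representation used by the
transplant of the implosion to the torus (Cao-Labora–Gómez-Serrano–Shi–Staffilani,
arXiv:2310.05325, Rem. 1.5) in `Summits/AtomisticToContinuum/HydrodynamicLimit` (item
`TypeOneIdealImplosion` of the route `ImplosionDichotomy`):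

* `exists_bound_iteratedFDeriv_of_scaling` — an abstract lemma: a smooth field on `ℝ³` which is
  asymptotically homogeneous of degree `p ≤ 0` with smooth scale/angle dependence,
  `f(λz) = λ^p V(λ^{−r}, z)` (`λ ≥ 1`, `½ < |z| < 2`), has ALL its Fréchet derivatives bounded on
  `ℝ³` (compactness on the unit ball; at `|y| = λ ≥ 1`,
  `Dⁿf(y) = λ^{p} DⁿV(λ^{−r}, ·)∘(λ⁻¹id)^{⊗n}` with `(λ^{−r}, y/λ)` in the compact `[0,1] × 𝕊²`);
* `exists_bound_iteratedFDeriv_profile` — hence every derivative of the profile fields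
  `Ū(y) = U(|y|)y/|y|`, `S̄(y) = S(|y|)` and of `S̄³` is bounded on `ℝ³`: property (1.6) p. 6 of
  the source, "`|∇ʲŪ| + |∇ʲS̄| ≲ ⟨R⟩^{−(r−1)−j}`", in the weak form `≲ 1` — the input of the
  polynomial bounds on all derivatives of the periodic implosion;
* `exists_radial_cutoff`, `contDiff_cutoff_mul` — radial plateau cut-offs on `ℝ³` and the
  smoothness of `χ(z)g(μ, z)` for `g` smooth off `{z = 0}`;
* `radialField_scaling`, `radialScalar_scaling`, `farField_form` — the scaling identities and
  the exact solution in far-field form: for `t < T`, `x ≠ 0`,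
  `u(t,x) = (r⁻¹|x|^{−r}A((T−t)|x|^{−r}))x`, `σ(t,x) = r⁻¹|x|^{1−r}B((T−t)|x|^{−r})` — smooth in
  `(t, x)` on `ℝ × (ℝ³ ∖ {0})` across the blow-up time, with the explicit terminal state
  `((A(0)/r)|x|^{−r}x, (B(0)/r)|x|^{1−r})` at `t = T`.

## Mathlib / tree search

Mathlib: `ContinuousLinearMap.iteratedFDeriv_comp_right`, `iteratedFDeriv_comp_add_left`,
`Filter.EventuallyEq.iteratedFDeriv`, `iteratedFDeriv_const_smul_apply'`,
`ContinuousMultilinearMap.norm_compContinuousLinearMap_le`, `isCompact_sphere`,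
`Real.smoothTransition`, `contDiffAt_norm`. Tree: `farField_of_profile`
(`CompressibleEulerImplosionFarField`). `lean search 'bound_iteratedFDeriv.*scal|homogeneous.*iteratedFDeriv'`:
nothing of this kind in the tree.

## References

* G. Cao-Labora, J. Gómez-Serrano, J. Shi, G. Staffilani, arXiv:2310.05325 = Camb. J. Math. 13
  (2025), (1.6) p. 6, §1.3 p. 5, Rem. 1.5 p. 7. [`CaolaboraEtAl2025`]
* T. Buckmaster, G. Cao-Labora, J. Gómez-Serrano, arXiv:2208.09445 = Forum Math. Pi 13 (2025),
  Thm 1.1. [`BuckmasterCaolaboraGomezserrano2025`]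
-/

noncomputable section

open Set Filter Topology Metric
open scoped ContDiff

namespace Literature.Analysis.FluidPDE

namespace CaolaboraEtAl2025

open Literature.MathematicalPhysics.KineticTheory (V3)

variable {F : Type*} [NormedAddCommGroup F] [NormedSpace ℝ F]

/-- **Scaling ⇒ bounded derivatives.** Let `f : ℝ³ → F` be smooth and asymptotically
homogeneous of degree `p ≤ 0` in the sense that `f(λz) = λ^p V(λ^{-r}, z)` for `λ ≥ 1` and
`½ < |z| < 2`, with `V` smooth on `ℝ × ℝ³` and `r > 0`. Then every derivative of `f` is bounded
on `ℝ³`: on the unit ball by compactness, and at `|y| = λ ≥ 1` because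
`Dⁿf(y) = λ^{p−n} DⁿV(λ^{−r}, y/λ) ∘ (id, …, id)` with `(λ^{−r}, y/λ)` in the compact
`[0,1] × 𝕊²`. [folklore] -/
theorem exists_bound_iteratedFDeriv_of_scaling {f : V3 → F} {V : ℝ × V3 → F} {p r : ℝ}
    (hp : p ≤ 0) (hr : 0 < r) (hf : ContDiff ℝ ∞ f) (hV : ContDiff ℝ ∞ V)
    (hfV : ∀ l : ℝ, 1 ≤ l → ∀ z : V3, 1 / 2 < ‖z‖ → ‖z‖ < 2 → f (l • z) = l ^ p • V (l ^ (-r), z))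
    (n : ℕ) : ∃ C : ℝ, ∀ y : V3, ‖iteratedFDeriv ℝ n f y‖ ≤ C := by
  -- bound on the unit ball
  obtain ⟨C₀, hC₀⟩ := (isCompact_closedBall (0 : V3) 1).exists_bound_of_continuousOn
    ((hf.continuous_iteratedFDeriv (by exact_mod_cast le_top (a := (n : ℕ∞)))).continuousOn)
  -- bound for `V` on `[0,1] × 𝕊²`
  have hK : IsCompact (Icc (0 : ℝ) 1 ×ˢ sphere (0 : V3) 1) := isCompact_Icc.prod (isCompact_sphere 0 1)
  obtain ⟨M, hM⟩ := hK.exists_bound_of_continuousOn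
    ((hV.continuous_iteratedFDeriv (by exact_mod_cast le_top (a := (n : ℕ∞)))).continuousOn)
  refine ⟨max C₀ M, fun y => ?_⟩
  by_cases hy : ‖y‖ ≤ 1
  · exact (hC₀ y (mem_closedBall_zero_iff.2 hy)).trans (le_max_left _ _)
  -- `|y| = λ > 1`
  rw [not_le] at hy
  set l : ℝ := ‖y‖ with hl
  have hl1 : 1 ≤ l := hy.le
  have hl0 : 0 < l := by linarith
  set z : V3 := l⁻¹ • y with hz
  have hz1 : ‖z‖ = 1 := by rw [hz, norm_smul, norm_inv, Real.norm_of_nonneg hl0.le, inv_mul_cancel₀ hl0.ne']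
  -- the affine reparametrisation `w ↦ (λ^{-r}, w/λ)`
  set L : V3 →L[ℝ] ℝ × V3 := (ContinuousLinearMap.inr ℝ ℝ V3).comp (l⁻¹ • ContinuousLinearMap.id ℝ V3)
    with hL
  have hLapply : ∀ w : V3, L w = (0, l⁻¹ • w) := fun w => by simp [hL]
  have hLnorm : ‖L‖ ≤ 1 := by
    refine ContinuousLinearMap.opNorm_le_bound _ zero_le_one fun w => ?_
    rw [hLapply, Prod.norm_mk, norm_zero, norm_smul, norm_inv, Real.norm_of_nonneg hl0.le, one_mul]
    refine max_le (norm_nonneg _) ?_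
    exact (mul_le_of_le_one_left (norm_nonneg _) (inv_le_one_of_one_le₀ hl1))
  set a : ℝ × V3 := (l ^ (-r), 0) with ha
  set g : V3 → F := fun w => l ^ p • V (a + L w) with hg
  -- `f = g` near `y`
  have hfg : f =ᶠ[𝓝 y] g := by
    have hcont : ContinuousAt (fun w : V3 => ‖l⁻¹ • w‖) y := (continuous_const_smul _).norm.continuousAt
    have h1 : ∀ᶠ w in 𝓝 y, 1 / 2 < ‖l⁻¹ • w‖ ∧ ‖l⁻¹ • w‖ < 2 := by
      have hy1 : ‖l⁻¹ • y‖ = 1 := hz1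
      have e1 : ∀ᶠ w in 𝓝 y, 1 / 2 < ‖l⁻¹ • w‖ :=
        hcont.eventually (lt_mem_nhds (show (1 : ℝ) / 2 < ‖l⁻¹ • y‖ by rw [hy1]; norm_num))
      have e2 : ∀ᶠ w in 𝓝 y, ‖l⁻¹ • w‖ < 2 :=
        hcont.eventually (gt_mem_nhds (show ‖l⁻¹ • y‖ < 2 by rw [hy1]; norm_num))
      exact e1.and e2
    filter_upwards [h1] with w hw
    have key := hfV l hl1 (l⁻¹ • w) hw.1 hw.2
    rw [smul_inv_smul₀ hl0.ne'] at key
    rw [key, hg]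
    simp only [hLapply, ha, Prod.mk_add_mk, add_zero, zero_add]
  rw [(hfg.iteratedFDeriv ℝ n).eq_of_nhds]
  -- derivatives of `g`
  have hVa : ContDiff ℝ ∞ fun q : ℝ × V3 => V (a + q) := hV.comp (contDiff_const.add contDiff_id)
  have hcomp : ContDiff ℝ ∞ fun w : V3 => V (a + L w) := hVa.comp L.contDiff
  have h1 : iteratedFDeriv ℝ n g y = l ^ p • iteratedFDeriv ℝ n (fun w => V (a + L w)) y := by
    rw [hg]
    exact iteratedFDeriv_const_smul_apply' ((hcomp.of_le (by exact_mod_cast le_top)).contDiffAt)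
  have h2 : iteratedFDeriv ℝ n (fun w => V (a + L w)) y =
      (iteratedFDeriv ℝ n (fun q : ℝ × V3 => V (a + q)) (L y)).compContinuousLinearMap fun _ => L :=
    L.iteratedFDeriv_comp_right (f := fun q : ℝ × V3 => V (a + q)) hVa y (i := n) (by exact_mod_cast le_top)
  have h3 : iteratedFDeriv ℝ n (fun q : ℝ × V3 => V (a + q)) (L y) = iteratedFDeriv ℝ n V (a + L y) :=
    iteratedFDeriv_comp_add_left n a (L y)
  have hmem : a + L y ∈ Icc (0 : ℝ) 1 ×ˢ sphere (0 : V3) 1 := by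
    rw [hLapply, ha, Prod.mk_add_mk, add_zero, zero_add]
    refine ⟨⟨(Real.rpow_pos_of_pos hl0 _).le, ?_⟩, by simpa [hz] using hz1⟩
    exact Real.rpow_le_one_of_one_le_of_nonpos hl1 (by linarith)
  rw [h1, h2, h3, norm_smul]
  have hlp : ‖(l : ℝ) ^ p‖ ≤ 1 := by
    rw [Real.norm_of_nonneg (Real.rpow_nonneg hl0.le _)]
    exact Real.rpow_le_one_of_one_le_of_nonpos hl1 hp
  have hD : ‖(iteratedFDeriv ℝ n V (a + L y)).compContinuousLinearMap fun _ => L‖ ≤ M := by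
    refine (ContinuousMultilinearMap.norm_compContinuousLinearMap_le _ _).trans ?_
    have hprod : ∏ _i : Fin n, ‖L‖ ≤ 1 := Finset.prod_le_one (fun _ _ => norm_nonneg _) fun _ _ => hLnorm
    have hM0 : 0 ≤ M := (norm_nonneg _).trans (hM _ hmem)
    calc ‖iteratedFDeriv ℝ n V (a + L y)‖ * ∏ _i : Fin n, ‖L‖ ≤ M * 1 :=
          mul_le_mul (hM _ hmem) hprod (Finset.prod_nonneg fun _ _ => norm_nonneg _) hM0
      _ = M := mul_one M
  calc ‖(l : ℝ) ^ p‖ * ‖(iteratedFDeriv ℝ n V (a + L y)).compContinuousLinearMap fun _ => L‖ ≤ 1 * M :=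
        mul_le_mul hlp hD (norm_nonneg _) zero_le_one
    _ = M := one_mul M
    _ ≤ max C₀ M := le_max_right _ _

/-! ### The annular cut-off -/

/-- **Radial plateau cut-offs on `ℝ³`.** For `0 < a < b` there is a smooth `χ : ℝ³ → [0, 1]`
vanishing on `|z| ≤ a` and equal to `1` on `|z| ≥ b` (Mathlib's `Real.smoothTransition` of
`(|z|² − a²)/(b² − a²)`). [folklore] -/
theorem exists_radial_cutoff {a b : ℝ} (ha : 0 < a) (hab : a < b) :
    ∃ χ : V3 → ℝ, ContDiff ℝ ∞ χ ∧ (∀ z, ‖z‖ ≤ a → χ z = 0) ∧ (∀ z, b ≤ ‖z‖ → χ z = 1) ∧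
      (∀ z, 0 ≤ χ z ∧ χ z ≤ 1) := by
  have hb : 0 < b := ha.trans hab
  have hd : 0 < b ^ 2 - a ^ 2 := by nlinarith
  refine ⟨fun z => Real.smoothTransition ((‖z‖ ^ 2 - a ^ 2) / (b ^ 2 - a ^ 2)), ?_,
    fun z hz => ?_, fun z hz => ?_, fun z => ⟨Real.smoothTransition.nonneg _, Real.smoothTransition.le_one _⟩⟩
  · exact Real.smoothTransition.contDiff.comp
      (((contDiff_norm_sq ℝ).sub contDiff_const).div_const _)
  · refine Real.smoothTransition.zero_of_nonpos (div_nonpos_of_nonpos_of_nonneg ?_ hd.le)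
    nlinarith [norm_nonneg z]
  · refine Real.smoothTransition.one_of_one_le ?_
    rw [le_div_iff₀ hd]
    nlinarith [norm_nonneg z]

/-- Smoothness of `(μ, z) ↦ χ(z) g(μ, z)` on `ℝ × ℝ³` when `χ` vanishes on a ball around
`z = 0` and `g` is smooth off `{z = 0}`: near `z = 0` the product vanishes identically.
[folklore] -/
theorem contDiff_cutoff_mul {G : Type*} [NormedAddCommGroup G] [NormedSpace ℝ G]
    {χ : V3 → ℝ} (hχ : ContDiff ℝ ∞ χ) {δ : ℝ} (hδ : 0 < δ) (hχ0 : ∀ z, ‖z‖ ≤ δ → χ z = 0)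
    {g : ℝ × V3 → G} (hg : ∀ q : ℝ × V3, q.2 ≠ 0 → ContDiffAt ℝ ∞ g q) :
    ContDiff ℝ ∞ fun q : ℝ × V3 => χ q.2 • g q := by
  refine contDiff_iff_contDiffAt.2 fun q => ?_
  by_cases hq : q.2 = 0
  · have hev : (fun q : ℝ × V3 => χ q.2 • g q) =ᶠ[𝓝 q] fun _ => 0 := by
      have h1 : ∀ᶠ q' : ℝ × V3 in 𝓝 q, ‖q'.2‖ < δ := by
        have hc : ContinuousAt (fun q' : ℝ × V3 => ‖q'.2‖) q := continuous_snd.norm.continuousAt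
        exact hc.eventually (gt_mem_nhds (show ‖q.2‖ < δ by rw [hq, norm_zero]; exact hδ))
      filter_upwards [h1] with q' hq'
      rw [hχ0 q'.2 hq'.le, zero_smul]
    exact (contDiffAt_const (c := (0 : G))).congr_of_eventuallyEq hev
  · exact (hχ.contDiffAt.comp q contDiffAt_snd).smul (hg q hq)

/-- `(μ, z) ↦ ‖z‖^p` is smooth at points with `z ≠ 0`. [folklore] -/
theorem contDiffAt_norm_rpow {p : ℝ} {q : ℝ × V3} (hq : q.2 ≠ 0) :
    ContDiffAt ℝ ∞ (fun q : ℝ × V3 => ‖q.2‖ ^ p) q :=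
  ((contDiffAt_norm ℝ hq).comp q contDiffAt_snd).rpow_const_of_ne (norm_ne_zero_iff.2 hq)

/-- Smoothness of the far-field kernel `(μ, z) ↦ ‖z‖^p G(μ ‖z‖^{-r})` at `z ≠ 0` for `G`
smooth. [folklore] -/
theorem contDiffAt_farField_kernel {G : ℝ → ℝ} (hG : ContDiff ℝ ∞ G) (p r : ℝ) {q : ℝ × V3}
    (hq : q.2 ≠ 0) :
    ContDiffAt ℝ ∞ (fun q : ℝ × V3 => ‖q.2‖ ^ p * G (q.1 * ‖q.2‖ ^ (-r))) q :=
  (contDiffAt_norm_rpow hq).mul (hG.contDiffAt.comp q (contDiffAt_fst.mul (contDiffAt_norm_rpow hq)))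

/-! ### Scaling identities of the far-field representation -/

/-- `(l ζ)^q = l^q ζ^q` and friends: the radial velocity field of a profile
`U(ζ) = ζ^{1−r}A(ζ^{−r})` scales as `Ū(l z) = l^{1−r} (|z|^{−r} A(l^{−r}|z|^{−r})) z`. [folklore] -/
theorem radialField_scaling {U A : ℝ → ℝ} {r : ℝ}
    (hU : ∀ ζ : ℝ, 0 < ζ → U ζ = ζ ^ (1 - r) * A (ζ ^ (-r))) {l : ℝ} (hl : 0 < l) {z : V3}
    (hz : z ≠ 0) :
    (U ‖l • z‖ / ‖l • z‖) • (l • z) = l ^ (1 - r) • ((‖z‖ ^ (-r) * A (l ^ (-r) * ‖z‖ ^ (-r))) • z) := by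
  have hz0 : 0 < ‖z‖ := norm_pos_iff.2 hz
  have hn : ‖l • z‖ = l * ‖z‖ := by rw [norm_smul, Real.norm_of_nonneg hl.le]
  have hlz : 0 < l * ‖z‖ := mul_pos hl hz0
  rw [hn, hU _ hlz, Real.mul_rpow hl.le hz0.le, Real.mul_rpow hl.le hz0.le, smul_smul, smul_smul]
  congr 1
  have h1 : ‖z‖ ^ (1 - r) = ‖z‖ * ‖z‖ ^ (-r) := by
    rw [sub_eq_add_neg, Real.rpow_add hz0, Real.rpow_one]
  rw [h1]
  field_simp

/-- The radial scalar field of a profile `S(ζ) = ζ^{1−r}B(ζ^{−r})` scales as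
`S̄(l z) = l^{1−r} |z|^{1−r} B(l^{−r}|z|^{−r})`, and its cube accordingly. [folklore] -/
theorem radialScalar_scaling {S B : ℝ → ℝ} {r : ℝ}
    (hS : ∀ ζ : ℝ, 0 < ζ → S ζ = ζ ^ (1 - r) * B (ζ ^ (-r))) {l : ℝ} (hl : 0 < l) {z : V3}
    (hz : z ≠ 0) :
    S ‖l • z‖ = l ^ (1 - r) * (‖z‖ ^ (1 - r) * B (l ^ (-r) * ‖z‖ ^ (-r))) ∧
      S ‖l • z‖ ^ 3 = l ^ (3 * (1 - r)) * (‖z‖ ^ (3 * (1 - r)) * B (l ^ (-r) * ‖z‖ ^ (-r)) ^ 3) := by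
  have hz0 : 0 < ‖z‖ := norm_pos_iff.2 hz
  have hn : ‖l • z‖ = l * ‖z‖ := by rw [norm_smul, Real.norm_of_nonneg hl.le]
  have hlz : 0 < l * ‖z‖ := mul_pos hl hz0
  have h1 : S ‖l • z‖ = l ^ (1 - r) * (‖z‖ ^ (1 - r) * B (l ^ (-r) * ‖z‖ ^ (-r))) := by
    rw [hn, hS _ hlz, Real.mul_rpow hl.le hz0.le, Real.mul_rpow hl.le hz0.le, mul_assoc]
  refine ⟨h1, ?_⟩
  rw [h1, mul_pow, mul_pow, ← Real.rpow_natCast (l ^ (1 - r)) 3, ← Real.rpow_mul hl.le,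
    ← Real.rpow_natCast (‖z‖ ^ (1 - r)) 3, ← Real.rpow_mul hz0.le]
  push_cast
  ring_nf

/-! ### Bounded derivatives of all orders for the profile fields -/

/-- **All derivatives of the profile fields are bounded on `ℝ³`.** For the `γ = 5/3` profile of
Buckmaster–Cao-Labora–Gómez-Serrano as recorded in the vendored fact (`1 < r < 2`), every
Fréchet derivative of the radial velocity field `Ū(y) = U(|y|)y/|y|`, of the sound-speed field
`S̄(y) = S(|y|)` and of its cube `S̄³` (the density profile up to constants) is bounded on `ℝ³` —
property (1.6) of Cao-Labora–Gómez-Serrano–Shi–Staffilani, p. 6, "`|∇ʲŪ| + |∇ʲS̄| ≲ ⟨R⟩^{−(r−1)−j}`",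
in the weak form `≲ 1`. Proof: by `farField_of_profile` the fields are asymptotically
homogeneous of negative degree with smooth angular/scale dependence, and
`exists_bound_iteratedFDeriv_of_scaling` applies.
[cite: CaolaboraEtAl2025, (1.6) p. 6] [cite: BuckmasterCaolaboraGomezserrano2025, Thm 1.1] -/
theorem exists_bound_iteratedFDeriv_profile {r : ℝ} {U S : ℝ → ℝ} (hr1 : 1 < r) (hr2 : r < 2)
    (hU : ContDiff ℝ ∞ fun y : V3 => (U ‖y‖ / ‖y‖) • y) (hS : ContDiff ℝ ∞ fun y : V3 => S ‖y‖)
    (hode : ∀ ζ : ℝ, 0 < ζ →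
      (r - 1) * U ζ + (ζ + U ζ) * deriv U ζ + 1 / 3 * S ζ * deriv S ζ = 0 ∧
      (r - 1) * S ζ + (ζ + U ζ) * deriv S ζ + 1 / 3 * S ζ * (deriv U ζ + 2 * U ζ / ζ) = 0)
    (hSpos : ∀ ζ : ℝ, 0 ≤ ζ → 0 < S ζ)
    (hlimU : Tendsto (fun ζ => U ζ / ζ) atTop (𝓝 0))
    (hlimS : Tendsto (fun ζ => S ζ / ζ) atTop (𝓝 0)) (n : ℕ) :
    ∃ C : ℝ, ∀ y : V3, ‖iteratedFDeriv ℝ n (fun y : V3 => (U ‖y‖ / ‖y‖) • y) y‖ ≤ C ∧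
      ‖iteratedFDeriv ℝ n (fun y : V3 => S ‖y‖) y‖ ≤ C ∧
      ‖iteratedFDeriv ℝ n (fun y : V3 => S ‖y‖ ^ 3) y‖ ≤ C := by
  have hr0 : 0 < r := by linarith
  obtain ⟨A, B, hA, hB, -, hrep⟩ := farField_of_profile hr1 hr2 hU hS hode hSpos hlimU hlimS
  obtain ⟨χ, hχ, hχ0, hχ1, -⟩ := exists_radial_cutoff (a := 1 / 4) (b := 1 / 2) (by norm_num) (by norm_num)
  have hq4 : (0 : ℝ) < 1 / 4 := by norm_num
  -- velocity
  obtain ⟨C₁, hC₁⟩ := exists_bound_iteratedFDeriv_of_scaling (p := 1 - r) (r := r)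
    (f := fun y : V3 => (U ‖y‖ / ‖y‖) • y)
    (V := fun q : ℝ × V3 => χ q.2 • ((‖q.2‖ ^ (-r) * A (q.1 * ‖q.2‖ ^ (-r))) • q.2))
    (by linarith) hr0 hU
    (contDiff_cutoff_mul hχ hq4 hχ0 fun q hq => (contDiffAt_farField_kernel hA (-r) r hq).smul contDiffAt_snd)
    (fun l hl z hz1 _ => by
      have hz : z ≠ 0 := by rintro rfl; rw [norm_zero] at hz1; linarith
      rw [radialField_scaling (fun ζ hζ => (hrep ζ hζ).1) (by linarith) hz, hχ1 z hz1.le, one_smul])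
    n
  -- sound speed
  obtain ⟨C₂, hC₂⟩ := exists_bound_iteratedFDeriv_of_scaling (p := 1 - r) (r := r)
    (f := fun y : V3 => S ‖y‖)
    (V := fun q : ℝ × V3 => χ q.2 • (‖q.2‖ ^ (1 - r) * B (q.1 * ‖q.2‖ ^ (-r))))
    (by linarith) hr0 hS (contDiff_cutoff_mul hχ hq4 hχ0 fun q hq => contDiffAt_farField_kernel hB _ r hq)
    (fun l hl z hz1 _ => by
      have hz : z ≠ 0 := by rintro rfl; rw [norm_zero] at hz1; linarith
      rw [(radialScalar_scaling (fun ζ hζ => (hrep ζ hζ).2) (by linarith) hz).1, hχ1 z hz1.le,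
        one_smul, smul_eq_mul])
    n
  -- density profile `S̄³`
  have hB3 : ContDiff ℝ ∞ fun s => B s ^ 3 := hB.pow 3
  obtain ⟨C₃, hC₃⟩ := exists_bound_iteratedFDeriv_of_scaling (p := 3 * (1 - r)) (r := r)
    (f := fun y : V3 => S ‖y‖ ^ 3)
    (V := fun q : ℝ × V3 => χ q.2 • (‖q.2‖ ^ (3 * (1 - r)) * B (q.1 * ‖q.2‖ ^ (-r)) ^ 3))
    (by nlinarith) hr0 (hS.pow 3)
    (contDiff_cutoff_mul hχ hq4 hχ0 fun q hq => contDiffAt_farField_kernel hB3 _ r hq)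
    (fun l hl z hz1 _ => by
      have hz : z ≠ 0 := by rintro rfl; rw [norm_zero] at hz1; linarith
      rw [(radialScalar_scaling (fun ζ hζ => (hrep ζ hζ).2) (by linarith) hz).2, hχ1 z hz1.le,
        one_smul, smul_eq_mul])
    n
  exact ⟨max C₁ (max C₂ C₃), fun y => ⟨(hC₁ y).trans (le_max_left _ _),
    (hC₂ y).trans ((le_max_left _ _).trans (le_max_right _ _)),
    (hC₃ y).trans ((le_max_right _ _).trans (le_max_right _ _))⟩⟩

/-! ### The exact solution in far-field form -/

/-- **The exact self-similar solution in far-field form.** With the representation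
`U(ζ) = ζ^{1−r}A(ζ^{−r})`, `S(ζ) = ζ^{1−r}B(ζ^{−r})` of `farField_of_profile`, the self-similar
velocity and sound speed `u = r⁻¹(T−t)^{1/r−1}Ū(x/(T−t)^{1/r})`,
`σ = r⁻¹(T−t)^{1/r−1}S̄(x/(T−t)^{1/r})` read, for `t < T` and `x ≠ 0`,
`u(t, x) = (r⁻¹|x|^{−r}A((T−t)|x|^{−r})) x` and `σ(t, x) = r⁻¹|x|^{1−r}B((T−t)|x|^{−r})` —
expressions which are smooth in `(t, x)` on all of `ℝ × (ℝ³ ∖ {0})`, across `t = T`.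
[cite: CaolaboraEtAl2025, §1.3 p. 5 (self-similar change of variables)] -/
theorem farField_form {U S A B : ℝ → ℝ} {r T t : ℝ} (hr : 0 < r)
    (hU : ∀ ζ : ℝ, 0 < ζ → U ζ = ζ ^ (1 - r) * A (ζ ^ (-r)))
    (hS : ∀ ζ : ℝ, 0 < ζ → S ζ = ζ ^ (1 - r) * B (ζ ^ (-r))) (ht : t < T) {x : V3} (hx : x ≠ 0) :
    (r⁻¹ * (T - t) ^ (1 / r - 1)) •
        ((U ‖(T - t) ^ (-1 / r) • x‖ / ‖(T - t) ^ (-1 / r) • x‖) • ((T - t) ^ (-1 / r) • x)) =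
      (r⁻¹ * ‖x‖ ^ (-r) * A ((T - t) * ‖x‖ ^ (-r))) • x ∧
    (r⁻¹ * (T - t) ^ (1 / r - 1)) * S ‖(T - t) ^ (-1 / r) • x‖ =
      r⁻¹ * ‖x‖ ^ (1 - r) * B ((T - t) * ‖x‖ ^ (-r)) := by
  have hl : 0 < T - t := sub_pos.2 ht
  have he : 0 < (T - t) ^ (-1 / r) := Real.rpow_pos_of_pos hl _
  have her : ((T - t) ^ (-1 / r)) ^ (-r) = T - t := by
    rw [← Real.rpow_mul hl.le, show (-1 / r) * (-r) = 1 by field_simp, Real.rpow_one]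
  have he1r : (T - t) ^ (1 / r - 1) * ((T - t) ^ (-1 / r)) ^ (1 - r) = 1 := by
    rw [← Real.rpow_mul hl.le, ← Real.rpow_add hl]
    have : 1 / r - 1 + -1 / r * (1 - r) = 0 := by field_simp; ring
    rw [this, Real.rpow_zero]
  constructor
  · rw [radialField_scaling hU he hx, her, smul_smul, smul_smul]
    congr 1
    calc r⁻¹ * (T - t) ^ (1 / r - 1) * ((T - t) ^ (-1 / r)) ^ (1 - r) *
          (‖x‖ ^ (-r) * A ((T - t) * ‖x‖ ^ (-r)))
        = r⁻¹ * ((T - t) ^ (1 / r - 1) * ((T - t) ^ (-1 / r)) ^ (1 - r)) *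
          (‖x‖ ^ (-r) * A ((T - t) * ‖x‖ ^ (-r))) := by ring
      _ = r⁻¹ * ‖x‖ ^ (-r) * A ((T - t) * ‖x‖ ^ (-r)) := by rw [he1r]; ring
  · rw [(radialScalar_scaling hS he hx).1, her]
    calc r⁻¹ * (T - t) ^ (1 / r - 1) * (((T - t) ^ (-1 / r)) ^ (1 - r) *
          (‖x‖ ^ (1 - r) * B ((T - t) * ‖x‖ ^ (-r))))
        = r⁻¹ * ((T - t) ^ (1 / r - 1) * ((T - t) ^ (-1 / r)) ^ (1 - r)) *
          (‖x‖ ^ (1 - r) * B ((T - t) * ‖x‖ ^ (-r))) := by ring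
      _ = r⁻¹ * ‖x‖ ^ (1 - r) * B ((T - t) * ‖x‖ ^ (-r)) := by rw [he1r]; ring

end CaolaboraEtAl2025

end Literature.Analysis.FluidPDE
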